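import Mathlib.Combinatorics.SetFamily.FourFunctions
import Summits.Ventures.PercRepro.ThetaMulti

/-!
# (Θ_∞): the transversal halves, the two-class and Daykin bounds, and the `∅` / `S` regime

Dossier proofs/MINE1-theoremS.md, Addendum 73 (mine-1, gen 38). For a multi-class instance
`A : ι → Finset (Finset α)` (ThetaMulti.lean) the multi-class difference family `multiD A` is,
as soon as there are two classes, exactly `{∅}` together with the Marica–Schönheim difference
families of the **transversal halves** `A i ∪ (A j)*`, `i ≠ j` — the `m`-class form of the
lane's three-half decomposition `thetaD_eq_union_diffs_transversal`. This file proves what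
follows from that decomposition and from Daykin's inequality alone, for ANY number of classes:

* `diffs_union_compls`, `diffs_transversal_subset_multiD`, `multiD_eq_biUnion_diffs_transversal`
  — the halves decomposition;
* `card_add_card_le_card_multiD` — **any two classes** `i ≠ j` satisfy
  `|A i| + |A j| ≤ |multiD A|` (only `Disjoint (A i) (compls (A j))` is used);
* `sum_mul_sum_le_card_multiD_sq` — **Daykin's bound**: for any split `I ⊔ J` of the classes,
  `(∑_{i ∈ I} |A i|) · (∑_{j ∈ J} |A j|) ≤ |multiD A|²` (the cross meets and co-joins of two
  disjoint groups of classes are multi-class differences);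
* `sum_card_le_card_multiD_of_univ_mem`, `sum_card_le_card_multiD_of_empty_mem` — **(Θ_∞) holds
  whenever some class contains the full set or the empty set**: `x ↦ S ∖ x` on that class and
  `x ↦ x` elsewhere (resp. `x ↦ x` and `x ↦ x*`) injects the instance into `multiD A`;
* `multiD_mono` — `multiD` is monotone in every class (the deletion bookkeeping).
-/

namespace PercRepro.MSTight

open Finset
open scoped FinsetFamily

variable {α : Type*} [DecidableEq α] [Fintype α]
variable {ι : Type*} [DecidableEq ι] [Fintype ι]

section Halves

/-- Membership in the cross term. -/
theorem mem_crossD {A B : Finset (Finset α)} {E : Finset α} :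
    E ∈ crossD A B ↔ E ∈ A ⊼ B ∨ E ∈ compls (A ⊻ B) := by
  unfold crossD
  exact mem_union

/-- The cross term is the cross part of the differences of the transversal `A ∪ B*`:
`crossD A B = A \\ B* ∪ B* \\ A`. -/
theorem crossD_eq_diffs_compls (A B : Finset (Finset α)) :
    crossD A B = A \\ compls B ∪ compls B \\ A := by
  rw [diffs_compls_eq_infs, compls_diffs_eq_compls_sups, sups_comm]
  rfl

/-- The differences of the transversal `A ∪ B*` are the within differences of `A` and of `B`
together with the cross term. -/
theorem diffs_union_compls (A B : Finset (Finset α)) :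
    (A ∪ compls B) \\ (A ∪ compls B) = A \\ A ∪ B \\ B ∪ crossD A B := by
  rw [diffs_union_left, diffs_union_right, diffs_union_right, diffs_compls_compls,
    crossD_eq_diffs_compls]
  ext E
  simp only [mem_union]
  tauto

/-- Every transversal half `A i ∪ (A j)*`, `i ≠ j`, has its differences inside `multiD A`. -/
theorem diffs_transversal_subset_multiD (A : ι → Finset (Finset α)) {i j : ι} (hij : i ≠ j) :
    (A i ∪ compls (A j)) \\ (A i ∪ compls (A j)) ⊆ multiD A := by
  rw [diffs_union_compls]
  intro E hE
  rw [mem_union, mem_union] at hE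
  rcases hE with (h | h) | h
  · exact mem_multiD_of_mem_diffs i h
  · exact mem_multiD_of_mem_diffs j h
  · exact mem_multiD_of_mem_crossD hij h

/-- **The halves decomposition**: with at least two classes, `multiD A` is `{∅}` together with
the difference families of all transversal halves `A i ∪ (A j)*`, `i ≠ j`. -/
theorem multiD_eq_biUnion_diffs_transversal [Nontrivial ι] (A : ι → Finset (Finset α)) :
    multiD A = {∅} ∪ (univ.filter fun p : ι × ι => p.1 ≠ p.2).biUnion
      fun p => (A p.1 ∪ compls (A p.2)) \\ (A p.1 ∪ compls (A p.2)) := by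
  apply Subset.antisymm
  · intro E hE
    rw [mem_multiD] at hE
    rw [mem_union, mem_singleton, mem_biUnion]
    rcases hE with h | ⟨i, h⟩ | ⟨i, j, hij, h⟩
    · exact Or.inl h
    · obtain ⟨j, hji⟩ := exists_ne i
      refine Or.inr ⟨(i, j), ?_, ?_⟩
      · simp only [mem_filter, mem_univ, true_and]
        exact hji.symm
      · rw [diffs_union_compls]
        exact mem_union_left _ (mem_union_left _ h)
    · refine Or.inr ⟨(i, j), ?_, ?_⟩
      · simp only [mem_filter, mem_univ, true_and]
        exact hij
      · rw [diffs_union_compls]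
        exact mem_union_right _ h
  · intro E hE
    rw [mem_union, mem_singleton, mem_biUnion] at hE
    rcases hE with rfl | ⟨⟨i, j⟩, hij, h⟩
    · exact empty_mem_multiD A
    · simp only [mem_filter, mem_univ, true_and] at hij
      exact diffs_transversal_subset_multiD A hij h

/-- `multiD` is monotone in every class. -/
theorem multiD_mono {A B : ι → Finset (Finset α)} (h : ∀ i, A i ⊆ B i) : multiD A ⊆ multiD B := by
  intro E hE
  rw [mem_multiD] at hE ⊢
  rcases hE with h0 | ⟨i, hi⟩ | ⟨i, j, hij, hij'⟩
  · exact Or.inl h0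
  · exact Or.inr (Or.inl ⟨i, diffs_subset (h i) (h i) hi⟩)
  · refine Or.inr (Or.inr ⟨i, j, hij, ?_⟩)
    rw [mem_crossD] at hij' ⊢
    rcases hij' with hm | hc
    · exact Or.inl (infs_subset (h i) (h j) hm)
    · rw [mem_compls] at hc ⊢
      exact Or.inr (sups_subset (h i) (h j) hc)

end Halves

section TwoClasses

/-- **The two-class bound for any two classes**: `|A i| + |A j| ≤ |multiD A|` whenever `i ≠ j` and
`A i` misses the complements of `A j` — Marica–Schönheim for the transversal half `A i ∪ (A j)*`. -/
theorem card_add_card_le_card_multiD (A : ι → Finset (Finset α)) {i j : ι} (hij : i ≠ j)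
    (h : Disjoint (A i) (compls (A j))) : (A i).card + (A j).card ≤ (multiD A).card := by
  have hF : (A i ∪ compls (A j)).card = (A i).card + (A j).card := by
    rw [card_union_of_disjoint h, card_compls]
  calc (A i).card + (A j).card = (A i ∪ compls (A j)).card := hF.symm
    _ ≤ ((A i ∪ compls (A j)) \\ (A i ∪ compls (A j))).card := card_le_card_diffs _
    _ ≤ (multiD A).card := card_le_card (diffs_transversal_subset_multiD A hij)

/-- The two-class bound in a valid instance. -/
theorem card_add_card_le_card_multiD_of_valid {A : ι → Finset (Finset α)} (hv : MultiValid A)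
    {i j : ι} (hij : i ≠ j) : (A i).card + (A j).card ≤ (multiD A).card :=
  card_add_card_le_card_multiD A hij (hv.2 i j hij).2

/-- Every single class is bounded by the multi-class family (Marica–Schönheim within the class). -/
theorem card_le_card_multiD (A : ι → Finset (Finset α)) (i : ι) :
    (A i).card ≤ (multiD A).card :=
  (card_le_card_diffs (A i)).trans
    (card_le_card fun _ h => mem_multiD_of_mem_diffs i h)

end TwoClasses

section Daykin

omit [DecidableEq ι] [Fintype ι] in
/-- In a valid instance the classes are pairwise disjoint, so a union of classes counts the sum. -/
theorem card_biUnion_classes {A : ι → Finset (Finset α)} (hv : MultiValid A) (I : Finset ι) :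
    (I.biUnion A).card = ∑ i ∈ I, (A i).card :=
  card_biUnion fun i _ j _ hij => (hv.2 i j hij).1

omit [DecidableEq ι] in
/-- `∑ᵢ |A i|` is the size of the instance `⋃ᵢ A i` when the instance is valid. -/
theorem sum_card_eq_card_biUnion_classes_univ {A : ι → Finset (Finset α)} (hv : MultiValid A) :
    ∑ i, (A i).card = (univ.biUnion A).card :=
  (card_biUnion_classes hv univ).symm

/-- Meets across two disjoint groups of classes are multi-class differences. -/
theorem infs_biUnion_subset_multiD (A : ι → Finset (Finset α)) {I J : Finset ι}
    (hIJ : Disjoint I J) : I.biUnion A ⊼ J.biUnion A ⊆ multiD A := by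
  intro E hE
  rw [mem_infs] at hE
  obtain ⟨x, hx, y, hy, rfl⟩ := hE
  rw [mem_biUnion] at hx hy
  obtain ⟨i, hi, hx⟩ := hx
  obtain ⟨j, hj, hy⟩ := hy
  have hij : i ≠ j := fun h => disjoint_left.1 hIJ hi (h ▸ hj)
  exact mem_multiD_of_mem_crossD hij (mem_union_left _ (inf_mem_infs hx hy))

/-- Co-joins across two disjoint groups of classes are multi-class differences. -/
theorem compls_sups_biUnion_subset_multiD (A : ι → Finset (Finset α)) {I J : Finset ι}
    (hIJ : Disjoint I J) : compls (I.biUnion A ⊻ J.biUnion A) ⊆ multiD A := by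
  intro E hE
  rw [mem_compls, mem_sups] at hE
  obtain ⟨x, hx, y, hy, hxy⟩ := hE
  rw [mem_biUnion] at hx hy
  obtain ⟨i, hi, hx⟩ := hx
  obtain ⟨j, hj, hy⟩ := hy
  have hij : i ≠ j := fun h => disjoint_left.1 hIJ hi (h ▸ hj)
  refine mem_multiD_of_mem_crossD hij (mem_union_right _ ?_)
  rw [mem_compls]
  exact hxy ▸ sup_mem_sups hx hy

/-- **Daykin's bound for a split of the classes**: for disjoint index sets `I`, `J`,
`(∑_{i ∈ I} |A i|) · (∑_{j ∈ J} |A j|) ≤ |multiD A|²` — the instance of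
`|𝒜| |ℬ| ≤ |𝒜 ⊼ ℬ| |𝒜 ⊻ ℬ|` for the two class unions, whose meets and co-joins are multi-class
differences. -/
theorem sum_mul_sum_le_card_multiD_sq {A : ι → Finset (Finset α)} (hv : MultiValid A)
    {I J : Finset ι} (hIJ : Disjoint I J) :
    (∑ i ∈ I, (A i).card) * (∑ j ∈ J, (A j).card) ≤ (multiD A).card ^ 2 := by
  rw [← card_biUnion_classes hv I, ← card_biUnion_classes hv J, sq]
  calc (I.biUnion A).card * (J.biUnion A).card
      ≤ (I.biUnion A ⊼ J.biUnion A).card * (I.biUnion A ⊻ J.biUnion A).card :=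
        le_card_infs_mul_card_sups _ _
    _ = (I.biUnion A ⊼ J.biUnion A).card *
          (compls (I.biUnion A ⊻ J.biUnion A)).card := by
        rw [card_compls]
    _ ≤ (multiD A).card * (multiD A).card :=
        Nat.mul_le_mul (card_le_card (infs_biUnion_subset_multiD A hIJ))
          (card_le_card (compls_sups_biUnion_subset_multiD A hIJ))

end Daykin

section Extremes

omit [DecidableEq ι] [Fintype ι] in
/-- `x ↦ S ∖ x` is injective. -/
theorem univ_sdiff_injective_aux {x y : Finset α} (h : univ \ x = univ \ y) : x = y := by
  calc x = univ \ (univ \ x) := (Finset.sdiff_sdiff_eq_self (subset_univ x)).symm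
    _ = univ \ (univ \ y) := by rw [h]
    _ = y := Finset.sdiff_sdiff_eq_self (subset_univ y)

/-- **(Θ_∞) when the full set is a member**: if `S ∈ A i₀`, then `x ↦ S ∖ x` on `A i₀` and
`x ↦ x` on the other classes inject the instance into `multiD A`. -/
theorem sum_card_le_card_multiD_of_univ_mem {A : ι → Finset (Finset α)} (hv : MultiValid A)
    {i₀ : ι} (h : (univ : Finset α) ∈ A i₀) : ∑ i, (A i).card ≤ (multiD A).card := by
  rw [sum_card_eq_card_biUnion_classes_univ hv]
  refine card_le_card_of_injOn (fun x => if x ∈ A i₀ then univ \ x else x) ?_ ?_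
  · intro x hx
    have hx' : x ∈ univ.biUnion A := by simpa using hx
    rw [mem_biUnion] at hx'
    obtain ⟨i, -, hxi⟩ := hx'
    simp only [mem_coe]
    by_cases hx0 : x ∈ A i₀
    · rw [if_pos hx0]
      exact mem_multiD_of_mem_diffs i₀ (sdiff_mem_diffs h hx0)
    · rw [if_neg hx0]
      have hi : i₀ ≠ i := fun hh => hx0 (hh ▸ hxi)
      have hm : univ ⊓ x ∈ A i₀ ⊼ A i := inf_mem_infs h hxi
      rw [inf_eq_inter, univ_inter] at hm
      exact mem_multiD_of_mem_crossD hi (mem_union_left _ hm)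
  · intro x hx y hy hxy
    have hx' : x ∈ univ.biUnion A := by simpa using hx
    have hy' : y ∈ univ.biUnion A := by simpa using hy
    rw [mem_biUnion] at hx' hy'
    obtain ⟨i, -, hxi⟩ := hx'
    obtain ⟨j, -, hyj⟩ := hy'
    simp only at hxy
    by_cases hx0 : x ∈ A i₀ <;> by_cases hy0 : y ∈ A i₀
    · rw [if_pos hx0, if_pos hy0] at hxy
      exact univ_sdiff_injective_aux hxy
    · rw [if_pos hx0, if_neg hy0] at hxy
      exfalso
      have hj : j ≠ i₀ := fun hh => hy0 (hh ▸ hyj)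
      have hyc : y ∈ compls (A i₀) := hxy ▸ compl_mem_compls hx0
      exact disjoint_left.1 (hv.2 j i₀ hj).2 hyj hyc
    · rw [if_neg hx0, if_pos hy0] at hxy
      exfalso
      have hi : i ≠ i₀ := fun hh => hx0 (hh ▸ hxi)
      have hxc : x ∈ compls (A i₀) := hxy ▸ compl_mem_compls hy0
      exact disjoint_left.1 (hv.2 i i₀ hi).2 hxi hxc
    · rw [if_neg hx0, if_neg hy0] at hxy
      exact hxy

/-- **(Θ_∞) when the empty set is a member**: if `∅ ∈ A i₀`, then `x ↦ x` on `A i₀` and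
`x ↦ x*` on the other classes inject the instance into `multiD A`. -/
theorem sum_card_le_card_multiD_of_empty_mem {A : ι → Finset (Finset α)} (hv : MultiValid A)
    {i₀ : ι} (h : (∅ : Finset α) ∈ A i₀) : ∑ i, (A i).card ≤ (multiD A).card := by
  rw [sum_card_eq_card_biUnion_classes_univ hv]
  refine card_le_card_of_injOn (fun x => if x ∈ A i₀ then x else univ \ x) ?_ ?_
  · intro x hx
    have hx' : x ∈ univ.biUnion A := by simpa using hx
    rw [mem_biUnion] at hx'
    obtain ⟨i, -, hxi⟩ := hx'
    simp only [mem_coe]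
    by_cases hx0 : x ∈ A i₀
    · rw [if_pos hx0]
      have hd : x \ ∅ ∈ A i₀ \\ A i₀ := sdiff_mem_diffs hx0 h
      rw [sdiff_empty] at hd
      exact mem_multiD_of_mem_diffs i₀ hd
    · rw [if_neg hx0]
      have hi : i₀ ≠ i := fun hh => hx0 (hh ▸ hxi)
      refine mem_multiD_of_mem_crossD hi (mem_union_right _ ?_)
      have hs : (∅ : Finset α) ⊔ x ∈ A i₀ ⊻ A i := sup_mem_sups h hxi
      rw [sup_eq_union, empty_union] at hs
      exact compl_mem_compls hs
  · intro x hx y hy hxy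
    have hx' : x ∈ univ.biUnion A := by simpa using hx
    have hy' : y ∈ univ.biUnion A := by simpa using hy
    rw [mem_biUnion] at hx' hy'
    obtain ⟨i, -, hxi⟩ := hx'
    obtain ⟨j, -, hyj⟩ := hy'
    simp only at hxy
    by_cases hx0 : x ∈ A i₀ <;> by_cases hy0 : y ∈ A i₀
    · rw [if_pos hx0, if_pos hy0] at hxy
      exact hxy
    · rw [if_pos hx0, if_neg hy0] at hxy
      exfalso
      have hj : j ≠ i₀ := fun hh => hy0 (hh ▸ hyj)
      have hyc : y ∈ compls (A i₀) := mem_compls.2 (hxy ▸ hx0)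
      exact disjoint_left.1 (hv.2 j i₀ hj).2 hyj hyc
    · rw [if_neg hx0, if_pos hy0] at hxy
      exfalso
      have hi : i ≠ i₀ := fun hh => hx0 (hh ▸ hxi)
      have hxc : x ∈ compls (A i₀) := mem_compls.2 (hxy ▸ hy0)
      exact disjoint_left.1 (hv.2 i i₀ hi).2 hxi hxc
    · rw [if_neg hx0, if_neg hy0] at hxy
      exact univ_sdiff_injective_aux hxy

/-- **(Θ_∞) holds for every valid instance in which some class contains `∅` or the full set.** -/
theorem sum_card_le_card_multiD_of_extreme_mem {A : ι → Finset (Finset α)} (hv : MultiValid A)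
    (h : ∃ i, (∅ : Finset α) ∈ A i ∨ (univ : Finset α) ∈ A i) :
    ∑ i, (A i).card ≤ (multiD A).card := by
  obtain ⟨i, hi | hi⟩ := h
  · exact sum_card_le_card_multiD_of_empty_mem hv hi
  · exact sum_card_le_card_multiD_of_univ_mem hv hi

end Extremes

end PercRepro.MSTight
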